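import Literature.ComputerArithmetic.FloatingPoint.Formats

/-!
# Bit-string codes of minifloat data: `encode` / `decode` and their round trip per named format

HONEST FRAMING (venture CertifiedArithmetic / cell `pub-lowprec`): certified error envelopes and
provably optimal rounding/accumulation schemes for low-precision formats under stated cost models;
every table by two implementations; no hardware or vendor claims.

A datum (sign `s`, exponent code `E`, trailing significand `T`) of a format with a `w`-bit exponent
field and `m` trailing bits has the `1 + w + m`-bit code `s·2^(w+m) + E·2^m + T`
[IEEE7542019, §3.4; MicikeviciusEtAl2022, Table 1]. `decode` inverts it and returns `none` exactly
on the codes that are not finite data (the format's NaN / ∞ patterns). Kernel-checked here for the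
OCP formats: the round trip on all data, the set of non-finite codes (`E4M3`: `0x7F, 0xFF`;
`E5M2`: `0x7C–0x7F, 0xFC–0xFF`; FP6/FP4: none), and the number of finite codes. These maps index
the exhaustive tables exported as JSON for the two-implementation diff.

Placement: venture development (dot-notation extensions of the Literature structure `MiniFloat`,
absolute `Literature.…` names, CONVENTIONS §2).
-/

namespace Literature.ComputerArithmetic.FloatingPoint

namespace MiniFloat

open Format

variable {φ : Format}

/-- Code of a datum for a `w`-bit exponent field: `s·2^(w+m) + E·2^m + T`.
[cite: IEEE7542019, §3.4] -/
def encode (w : ℕ) (x : MiniFloat φ) : ℕ :=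
  (if x.neg then 2 ^ (w + φ.manBits) else 0) + x.expCode * 2 ^ φ.manBits + x.man

/-- Decode a `1 + w + m`-bit code; `none` iff the code is not a finite datum of `φ` (NaN / ∞
patterns) or exceeds `1 + w + m` bits. [cite: IEEE7542019, §3.4] -/
def decode (φ : Format) (w : ℕ) (c : ℕ) : Option (MiniFloat φ) :=
  if h : (c / 2 ^ φ.manBits) % 2 ^ w ≤ φ.emaxCode ∧ c % 2 ^ φ.manBits < 2 ^ φ.manBits ∧
      ((c / 2 ^ φ.manBits) % 2 ^ w = φ.emaxCode → c % 2 ^ φ.manBits ≤ φ.topMan) ∧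
      c < 2 ^ (1 + w + φ.manBits) then
    some ⟨decide (2 ^ (w + φ.manBits) ≤ c), (c / 2 ^ φ.manBits) % 2 ^ w, c % 2 ^ φ.manBits,
      h.1, h.2.1, h.2.2.1⟩
  else none

/-- Round-trip test on one datum (Boolean, for kernel evaluation over `MiniFloat.all`). -/
def roundTrips (φ : Format) (w : ℕ) (x : MiniFloat φ) : Bool :=
  decide (decode φ w (encode w x) = some x)

/-- Codes below `2^(1+w+m)` that decode, re-encode to themselves (Boolean test on one code). -/
def codeStable (φ : Format) (w : ℕ) (c : ℕ) : Bool :=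
  match decode φ w c with
  | some x => encode w x == c
  | none => true

/-- The non-finite codes of a `1 + w + m`-bit format (those on which `decode` is `none`). -/
def nonFiniteCodes (φ : Format) (w : ℕ) : List ℕ :=
  (List.range (2 ^ (1 + w + φ.manBits))).filter fun c => (decode φ w c).isNone

/-! ### Kernel-checked round trips and special-code sets for the OCP formats -/

/-- `E2M1` (4-bit codes, `w = 2`): every datum round-trips, every code is stable, and all 16 codes
are finite (no NaN/∞). [cite: RouhaniEtAl2023MX, Table 1] -/
theorem E2M1_codes :
    (all E2M1).all (roundTrips E2M1 2) = true ∧ (List.range 16).all (codeStable E2M1 2) = true ∧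
    nonFiniteCodes E2M1 2 = [] := by decide +kernel

/-- `E3M2` (6-bit codes, `w = 3`): round trip, stability, all 64 codes finite.
[cite: RouhaniEtAl2023MX, Table 1] -/
theorem E3M2_codes :
    (all E3M2).all (roundTrips E3M2 3) = true ∧ (List.range 64).all (codeStable E3M2 3) = true ∧
    nonFiniteCodes E3M2 3 = [] := by decide +kernel

/-- `E2M3` (6-bit codes, `w = 2`): round trip, stability, all 64 codes finite.
[cite: RouhaniEtAl2023MX, Table 1] -/
theorem E2M3_codes :
    (all E2M3).all (roundTrips E2M3 2) = true ∧ (List.range 64).all (codeStable E2M3 2) = true ∧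
    nonFiniteCodes E2M3 2 = [] := by decide +kernel

/-- `E4M3` (8-bit codes, `w = 4`): round trip, stability, and exactly the two NaN codes
`0x7F = 127`, `0xFF = 255` are non-finite (no ∞). [cite: MicikeviciusEtAl2022, Table 1] -/
theorem E4M3_codes :
    (all E4M3).all (roundTrips E4M3 4) = true ∧ (List.range 256).all (codeStable E4M3 4) = true ∧
    nonFiniteCodes E4M3 4 = [127, 255] := by decide +kernel

/-- `E5M2` (8-bit codes, `w = 5`): round trip, stability, and exactly the codes
`0x7C–0x7F = 124…127` (`+∞`, 3 NaNs) and `0xFC–0xFF = 252…255` (`-∞`, 3 NaNs) are non-finite.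
[cite: MicikeviciusEtAl2022, Table 1] -/
theorem E5M2_codes :
    (all E5M2).all (roundTrips E5M2 5) = true ∧ (List.range 256).all (codeStable E5M2 5) = true ∧
    nonFiniteCodes E5M2 5 = [124, 125, 126, 127, 252, 253, 254, 255] := by decide +kernel

/-- Every `E4M3` datum round-trips through its byte (∀-form). [cite: MicikeviciusEtAl2022, Table 1] -/
theorem decode_encode_E4M3 (x : MiniFloat E4M3) : decode E4M3 4 (encode 4 x) = some x :=
  of_decide_eq_true (forall_of_all_all E4M3_codes.1 x)

/-- Every `E5M2` datum round-trips through its byte (∀-form). [cite: MicikeviciusEtAl2022, Table 1] -/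
theorem decode_encode_E5M2 (x : MiniFloat E5M2) : decode E5M2 5 (encode 5 x) = some x :=
  of_decide_eq_true (forall_of_all_all E5M2_codes.1 x)

/-- Every `E2M1` / `E3M2` / `E2M3` datum round-trips through its code (∀-form).
[cite: RouhaniEtAl2023MX, Table 1] -/
theorem decode_encode_FP4_FP6 :
    (∀ x : MiniFloat E2M1, decode E2M1 2 (encode 2 x) = some x) ∧
    (∀ x : MiniFloat E3M2, decode E3M2 3 (encode 3 x) = some x) ∧
    (∀ x : MiniFloat E2M3, decode E2M3 2 (encode 2 x) = some x) :=
  ⟨fun x => of_decide_eq_true (forall_of_all_all E2M1_codes.1 x),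
   fun x => of_decide_eq_true (forall_of_all_all E3M2_codes.1 x),
   fun x => of_decide_eq_true (forall_of_all_all E2M3_codes.1 x)⟩

end MiniFloat

end Literature.ComputerArithmetic.FloatingPoint
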